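import Literature.AnabelianGeometry.AbsoluteAnabelian.AbsTopII.InertiaDecompositionCore
import Literature.AnabelianGeometry.AbsoluteAnabelian.AbsTopII.DecompositionGroups
import Literature.AnabelianGeometry.AbsoluteAnabelian.AbsTopII.InertiaGroups
import Literature.AnabelianGeometry.AbsoluteAnabelian.FreeProcyclicStructure
import Literature.AnabelianGeometry.AbsoluteAnabelian.FreeProlCyclicEncoding

/-!
# [AbsTopII] Prop 1.3 (v), (vii) PROVED from their printed inputs, at the DPSC data

S. Mochizuki, *Topics in Absolute Anabelian Geometry II* [AbsTopII] (bib `MochizukiAbsTopII2013`;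
locators = PDF pages of the kurims manuscript `paper:url-585b8d0ad0d9`), §1, Proposition 1.3,
statement pp. 11–12, proof of (vii) p. 13, proof of (v) p. 16.

The cell types Prop 1.3 as PREDICATES on abstract DPSC data: abc-iut-L4-t4's `DPSCData` with the
REAL definitions `D_v := N_{Π_H}(Π_v)`, `I_v := Z_{Π_I}(Π_v)`, `D_e := N_{Π_H}(Π_e)`,
`I_e := Z_{Π_I}(Π_e)` (node), `I_e := Π_e` (cusp) of Def 1.2 (ii) p. 10 and the predicates
`Prop13iii/iv/v/vi/vii/ix` (`AbsTopII/DecompositionGroups.lean`, p404475), and abc-iut-L4-t6's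
`DPSCIndexData.Prop_1_3_i/ii/iii'/v'/viii/x` (`AbsTopII/InertiaGroups.lean`, p405221); each clause
is a separate named fact of the cell's FACT-LIST (F-0274 … F-0301).  The printed proof, however,
DERIVES (vii) and (v) from (ii)/(iii) + [CombGC] Prop 1.2 (i)(ii) + the graphicity of the outer
`H`-action (Def 1.2 (ii)) + "(iv) applied to various open subgroups of `Π_H`, `Π_I` [cf. Remark
1.2.1]: if `I_v ∩ γ·I_v·γ⁻¹ ≠ {1}` then `Π_v = γ·Π_v·γ⁻¹`" (p. 16) — by pure group theory,
kernel-checked in `AbsTopII/InertiaDecompositionCore.lean` (§A–§B) and ASSEMBLED here (§C):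

* `DPSCData.prop13vii_of_inputs : … → X.Prop13vii` and `DPSCIndexData.prop13vii_of_prop_1_3_ii`
  (the (ii)-inputs `Π_e ⊆ I_e`, `I_e·Π_𝔾 = Π_I` supplied by the typed `Prop_1_3_ii`);
* `DPSCData.prop13v_of_inputs : … → X.Prop13v` and `DPSCIndexData.prop13v_of_prop_1_3_iii'`
  (`I_v` infinite supplied by the typed `Prop_1_3_iii'`: `I_v ≅ Ẑ^Σ`);
* `DPSCIndexData.prop_1_3_v'_of_prop_1_3_iii' : … → X.Prop_1_3_v'` (the middle clause of (v):
  `D_v ∩ Π_I = C_{Π_I}(I_v) = N_{Π_I}(I_v) = Z_{Π_I}(I_v)` commensurably terminal in `Π_I`).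

Every geometric input is an explicit hypothesis spelled in Mathlib terms over `DPSCData` (no new
definition): graphicity `∀ g, ∃ v' γ ∈ Π_𝔾, g·Π_v·g⁻¹ = γ·Π_{v'}·γ⁻¹`; [CombGC] Prop 1.2 (i) in
finite-index form `(γ·Π_{v'}·γ⁻¹ ∩ Π_v` of finite index in `Π_v`) `⇒ v' = v` (the printed "open in"
form implies it for closed subgroups: `DPSCData.vertDet_of_isOpen_form` etc., the shape of
abc-iut-L3's `SemiGraphs.PSCDatum.VerticialOpenInterDeterminesVertex`); [CombGC] Prop 1.2 (ii)
as `IsCommensurablyTerminal ((X.vertSub v).subgroupOf X.PiG)` (verbatim the last conjunct of t4's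
`Prop13v`); the "(iv) at open subgroups" step verbatim.  A future `DPSCData`-from-`PSCDatum` bridge
can discharge the [CombGC] hypotheses BY NAME from L3's predicates.
HONEST FRAMING: classical group theory applied to a refereed, undisputed paper; the geometric inputs
stay hypotheses (typed ≠ proved); nothing here bears on [IUTchIII] Cor 3.12.
-/

open scoped Pointwise

namespace Literature.AnabelianGeometry.AbsoluteAnabelian

universe u

/-! ## §C. Assembly at the DPSC data of [AbsTopII] Def 1.2 (ii) -/

namespace DPSCData

variable (X : DPSCData.{u})

/-- The [CombGC] Prop 1.2 (i) hypothesis of the theorems below, in the PRINTED "open in `A₁`"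
form (the shape of abc-iut-L3's `SemiGraphs.PSCDatum.VerticialOpenInterDeterminesVertex`, with
`A₁ = Π_v`, `A₂ = γ·Π_{v'}·γ⁻¹`, `γ ∈ Π_𝔾`), implies the finite-index form used below, verticial
subgroups being closed ([CombGC] Def 1.1 (ii)). [cite: MochizukiCombGC2007, Prop 1.2(i) p.8] -/
theorem vertDet_of_isOpen_form (hcl : ∀ v : X.Vert, IsClosed (X.vertSub v : Set X.PiH))
    (h : ∀ (v v' : X.Vert) (γ : X.PiH), γ ∈ X.PiG →
      IsOpen ((((MulAut.conj γ • X.vertSub v') ⊓ X.vertSub v).subgroupOf (X.vertSub v) :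
        Subgroup ↥(X.vertSub v)) : Set ↥(X.vertSub v)) → v' = v) :
    ∀ (v v' : X.Vert) (γ : X.PiH), γ ∈ X.PiG →
      (MulAut.conj γ • X.vertSub v' ⊓ X.vertSub v).relIndex (X.vertSub v) ≠ 0 → v' = v :=
  fun v v' γ hγ hidx => of_isOpen_inf_subgroupOf (isClosed_mulAut_conj_smul (hcl v') γ) (h v v' γ hγ) hidx

/-- Idem for nodal subgroups. [cite: MochizukiCombGC2007, Prop 1.2(i) p.8] -/
theorem nodeDet_of_isOpen_form (hcl : ∀ e : X.Node, IsClosed (X.nodeSub e : Set X.PiH))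
    (h : ∀ (e e' : X.Node) (γ : X.PiH), γ ∈ X.PiG →
      IsOpen ((((MulAut.conj γ • X.nodeSub e') ⊓ X.nodeSub e).subgroupOf (X.nodeSub e) :
        Subgroup ↥(X.nodeSub e)) : Set ↥(X.nodeSub e)) → e' = e) :
    ∀ (e e' : X.Node) (γ : X.PiH), γ ∈ X.PiG →
      (MulAut.conj γ • X.nodeSub e' ⊓ X.nodeSub e).relIndex (X.nodeSub e) ≠ 0 → e' = e :=
  fun e e' γ hγ hidx => of_isOpen_inf_subgroupOf (isClosed_mulAut_conj_smul (hcl e') γ) (h e e' γ hγ) hidx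

/-- Idem for cuspidal subgroups. [cite: MochizukiCombGC2007, Prop 1.2(i) p.8] -/
theorem cuspDet_of_isOpen_form (hcl : ∀ e : X.Cusp, IsClosed (X.cuspSub e : Set X.PiH))
    (h : ∀ (e e' : X.Cusp) (γ : X.PiH), γ ∈ X.PiG →
      IsOpen ((((MulAut.conj γ • X.cuspSub e') ⊓ X.cuspSub e).subgroupOf (X.cuspSub e) :
        Subgroup ↥(X.cuspSub e)) : Set ↥(X.cuspSub e)) → e' = e) :
    ∀ (e e' : X.Cusp) (γ : X.PiH), γ ∈ X.PiG →
      (MulAut.conj γ • X.cuspSub e' ⊓ X.cuspSub e).relIndex (X.cuspSub e) ≠ 0 → e' = e :=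
  fun e e' γ hγ hidx => of_isOpen_inf_subgroupOf (isClosed_mulAut_conj_smul (hcl e') γ) (h e e' γ hγ) hidx

/-- **[AbsTopII] Prop 1.3 (vii), PROVED from its printed inputs** (proof p. 13): for every
node and every cusp `e`, `D_e = C_{Π_H}(Π_e) (= N_{Π_H}(Π_e))` is commensurably terminal in `Π_H`,
and for a node `I_e = D_e ∩ Π_I` — GIVEN (hypotheses, all printed inputs): graphicity of
conjugation on nodal / cuspidal subgroups (Def 1.2 (ii)); [CombGC] Prop 1.2 (i) for nodal /
cuspidal subgroups (finite-index form); [CombGC] Prop 1.2 (ii) (`Π_e` commensurably terminal in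
`Π_𝔾`); and from Prop 1.3 (ii): `Π_e ⊆ I_e` and `I_e · Π_𝔾 = Π_I` ("`I_e` surjects onto `I`").
The conclusion is literally abc-iut-L4-t4's predicate `DPSCData.Prop13vii` (FACT-LIST F-0280).
[cite: MochizukiAbsTopII2013, Prop 1.3 (vii) p.12] -/
theorem prop13vii_of_inputs
    (hGRn : ∀ (g : X.PiH) (e : X.Node), ∃ e' : X.Node, ∃ γ ∈ X.PiG,
      MulAut.conj g • X.nodeSub e = MulAut.conj γ • X.nodeSub e')
    (hDetn : ∀ (e e' : X.Node) (γ : X.PiH), γ ∈ X.PiG →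
      (MulAut.conj γ • X.nodeSub e' ⊓ X.nodeSub e).relIndex (X.nodeSub e) ≠ 0 → e' = e)
    (hCTn : ∀ e : X.Node, IsCommensurablyTerminal ((X.nodeSub e).subgroupOf X.PiG))
    (hGRc : ∀ (g : X.PiH) (e : X.Cusp), ∃ e' : X.Cusp, ∃ γ ∈ X.PiG,
      MulAut.conj g • X.cuspSub e = MulAut.conj γ • X.cuspSub e')
    (hDetc : ∀ (e e' : X.Cusp) (γ : X.PiH), γ ∈ X.PiG →
      (MulAut.conj γ • X.cuspSub e' ⊓ X.cuspSub e).relIndex (X.cuspSub e) ≠ 0 → e' = e)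
    (hCTc : ∀ e : X.Cusp, IsCommensurablyTerminal ((X.cuspSub e).subgroupOf X.PiG))
    (hii : ∀ e : X.Node, X.nodeSub e ≤ X.IvNode e ∧ X.IvNode e ⊔ X.PiG = X.PiI) :
    X.Prop13vii := by
  haveI : X.PiG.Normal := X.normal_PiG
  constructor
  · intro e
    have hCT : Subgroup.Commensurable.commensurator (X.nodeSub e) ⊓ X.PiG ≤ X.nodeSub e :=
      (isCommensurablyTerminal_subgroupOf_iff (X.nodeSub_le e)).mp (hCTn e)
    have hCN := commensurator_eq_normalizer_of_graphic X.nodeSub e (X.nodeSub_le e)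
      (fun g => hGRn g e) (fun j γ hγ h => hDetn e j γ hγ h) hCT
    have hDN := normalizer_inf_eq_of_ctIn (X.nodeSub_le e) hCT
    refine ⟨hCN.symm, isCommensurablyTerminal_normalizer_of hCN hDN, ?_⟩
    -- node clause `I_e = D_e ∩ Π_I`
    have hZ : X.IvNode e ≤ Subgroup.normalizer (X.nodeSub e : Set X.PiH) ⊓ X.PiI :=
      inf_le_inf_right _ (Subgroup.centralizer_le_normalizer _)
    exact eq_normalizer_inf_of_sup_eq (hii e).1 hZ (hii e).2 hDN
  · intro e
    have hCT : Subgroup.Commensurable.commensurator (X.cuspSub e) ⊓ X.PiG ≤ X.cuspSub e :=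
      (isCommensurablyTerminal_subgroupOf_iff (X.cuspSub_le e)).mp (hCTc e)
    have hCN := commensurator_eq_normalizer_of_graphic X.cuspSub e (X.cuspSub_le e)
      (fun g => hGRc g e) (fun j γ hγ h => hDetc e j γ hγ h) hCT
    have hDN := normalizer_inf_eq_of_ctIn (X.cuspSub_le e) hCT
    exact ⟨hCN.symm, isCommensurablyTerminal_normalizer_of hCN hDN⟩

/-- **[AbsTopII] Prop 1.3 (v), PROVED from its printed inputs** (proof p. 16): for every
vertex `v`, `D_v = C_{Π_H}(I_v) = N_{Π_H}(I_v)` is commensurably terminal in `Π_H` and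
`D_v ∩ Π_𝔾 = Π_v` is commensurably terminal in `Π_𝔾` — GIVEN: graphicity of conjugation on
verticial subgroups (Def 1.2 (ii)); [CombGC] Prop 1.2 (i) (finite-index form) and (ii) for
verticial subgroups; "(iv) applied to open subgroups" (p. 16: `I_v ∩ γ·I_v·γ⁻¹ ≠ {1} ⇒
Π_v = γ·Π_v·γ⁻¹`); and `I_v` infinite (it is `≅ Ẑ^Σ`, Prop 1.3 (iii)).  The conclusion is literally
abc-iut-L4-t4's predicate `DPSCData.Prop13v` (FACT-LIST F-0278).
[cite: MochizukiAbsTopII2013, Prop 1.3 (v) p.12] -/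
theorem prop13v_of_inputs
    (hGRv : ∀ (g : X.PiH) (v : X.Vert), ∃ v' : X.Vert, ∃ γ ∈ X.PiG,
      MulAut.conj g • X.vertSub v = MulAut.conj γ • X.vertSub v')
    (hDetv : ∀ (v v' : X.Vert) (γ : X.PiH), γ ∈ X.PiG →
      (MulAut.conj γ • X.vertSub v' ⊓ X.vertSub v).relIndex (X.vertSub v) ≠ 0 → v' = v)
    (hCTv : ∀ v : X.Vert, IsCommensurablyTerminal ((X.vertSub v).subgroupOf X.PiG))
    (hL : ∀ (v : X.Vert) (g : X.PiH), X.Iv v ⊓ MulAut.conj g • X.Iv v ≠ ⊥ →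
      MulAut.conj g • X.vertSub v = X.vertSub v)
    (hinf : ∀ v : X.Vert, Infinite ↥(X.Iv v)) :
    X.Prop13v := by
  haveI : X.PiG.Normal := X.normal_PiG
  haveI : X.PiI.Normal := X.normal_PiI
  intro v
  have hCT : Subgroup.Commensurable.commensurator (X.vertSub v) ⊓ X.PiG ≤ X.vertSub v :=
    (isCommensurablyTerminal_subgroupOf_iff (X.vertSub_le v)).mp (hCTv v)
  have hCN := commensurator_eq_normalizer_of_graphic X.vertSub v (X.vertSub_le v)
    (fun g => hGRv g v) (fun j γ hγ h => hDetv v j γ hγ h) hCT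
  have hDN := normalizer_inf_eq_of_ctIn (X.vertSub_le v) hCT
  haveI : Infinite ↥(Subgroup.centralizer (X.vertSub v : Set X.PiH) ⊓ X.PiI) := hinf v
  have hL' : ∀ g : X.PiH, ConjAct.toConjAct g •
      (Subgroup.centralizer (X.vertSub v : Set X.PiH) ⊓ X.PiI) ⊓
        (Subgroup.centralizer (X.vertSub v : Set X.PiH) ⊓ X.PiI) ≠ ⊥ →
      ConjAct.toConjAct g • X.vertSub v = X.vertSub v := by
    intro g hg
    apply hL v g
    rwa [inf_comm] at hg
  obtain ⟨h1, h2⟩ := normalizer_eq_commensurator_and_normalizer_centralizer_inf hL'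
  exact ⟨h1, h2, isCommensurablyTerminal_normalizer_of hCN hDN, hDN, hCTv v⟩

end DPSCData

namespace AbsTopII.DPSCIndexData

variable (X : DPSCIndexData.{u})

/-- `I_v ≅ Ẑ^Σ` (Prop 1.3 (iii), typed as `IsFreeProSigmaCyclic Σ I_v`) is infinite, `Σ` being a
nonempty set of primes. [cite: MochizukiAbsTopII2013, Prop 1.3 (iii) p.11] -/
theorem infinite_Iv_of_prop_1_3_iii' (h : X.Prop_1_3_iii') (v : X.Vert) : Infinite ↥(X.Iv v) := by
  obtain ⟨⟨p, hp⟩, hprime⟩ := X.sigma_prime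
  exact (h.1 v).2.infinite (hprime p hp) hp

/-- `I_v ≅ Ẑ^Σ` is abelian: a Hausdorff group with a dense cyclic subgroup is commutative.
[cite: MochizukiAbsTopII2013, Prop 1.3 (iii) p.11] -/
theorem le_centralizer_Iv_of_prop_1_3_iii' (h : X.Prop_1_3_iii') (v : X.Vert) :
    X.Iv v ≤ Subgroup.centralizer (X.Iv v : Set X.PiH) := by
  obtain ⟨g, hg⟩ := (h.1 v).2.exists_dense_zpowers
  intro x hx
  rw [Subgroup.mem_centralizer_iff]
  intro y hy
  have := mul_comm_of_dense_zpowers hg ⟨y, hy⟩ ⟨x, hx⟩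
  exact congrArg Subtype.val this

/-- **[AbsTopII] Prop 1.3 (vii) from Prop 1.3 (ii)** as typed (`DPSCIndexData.Prop_1_3_ii`,
F-0298) and the [CombGC] / graphicity inputs: the `(ii)`-hypothesis of
`DPSCData.prop13vii_of_inputs` is supplied by `Prop_1_3_ii`. [cite: MochizukiAbsTopII2013, Prop 1.3 (vii) p.12] -/
theorem prop13vii_of_prop_1_3_ii (hii : X.Prop_1_3_ii)
    (hGRn : ∀ (g : X.PiH) (e : X.Node), ∃ e' : X.Node, ∃ γ ∈ X.PiG,
      MulAut.conj g • X.nodeSub e = MulAut.conj γ • X.nodeSub e')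
    (hDetn : ∀ (e e' : X.Node) (γ : X.PiH), γ ∈ X.PiG →
      (MulAut.conj γ • X.nodeSub e' ⊓ X.nodeSub e).relIndex (X.nodeSub e) ≠ 0 → e' = e)
    (hCTn : ∀ e : X.Node, IsCommensurablyTerminal ((X.nodeSub e).subgroupOf X.PiG))
    (hGRc : ∀ (g : X.PiH) (e : X.Cusp), ∃ e' : X.Cusp, ∃ γ ∈ X.PiG,
      MulAut.conj g • X.cuspSub e = MulAut.conj γ • X.cuspSub e')
    (hDetc : ∀ (e e' : X.Cusp) (γ : X.PiH), γ ∈ X.PiG →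
      (MulAut.conj γ • X.cuspSub e' ⊓ X.cuspSub e).relIndex (X.cuspSub e) ≠ 0 → e' = e)
    (hCTc : ∀ e : X.Cusp, IsCommensurablyTerminal ((X.cuspSub e).subgroupOf X.PiG)) :
    X.Prop13vii :=
  X.toDPSCData.prop13vii_of_inputs hGRn hDetn hCTn hGRc hDetc hCTc
    fun e => ⟨(hii e).1.1, (hii e).1.2.2⟩

/-- **[AbsTopII] Prop 1.3 (v) from Prop 1.3 (iii)** as typed (`DPSCIndexData.Prop_1_3_iii'`, F-0299,
supplies "`I_v ≅ Ẑ^Σ`", hence `I_v` infinite) and the [CombGC] / graphicity / "(iv) at open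
subgroups" inputs. Conclusion: t4's `DPSCData.Prop13v` (F-0278). [cite: MochizukiAbsTopII2013, Prop 1.3 (v) p.12] -/
theorem prop13v_of_prop_1_3_iii' (hiii : X.Prop_1_3_iii')
    (hGRv : ∀ (g : X.PiH) (v : X.Vert), ∃ v' : X.Vert, ∃ γ ∈ X.PiG,
      MulAut.conj g • X.vertSub v = MulAut.conj γ • X.vertSub v')
    (hDetv : ∀ (v v' : X.Vert) (γ : X.PiH), γ ∈ X.PiG →
      (MulAut.conj γ • X.vertSub v' ⊓ X.vertSub v).relIndex (X.vertSub v) ≠ 0 → v' = v)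
    (hCTv : ∀ v : X.Vert, IsCommensurablyTerminal ((X.vertSub v).subgroupOf X.PiG))
    (hL : ∀ (v : X.Vert) (g : X.PiH), X.Iv v ⊓ MulAut.conj g • X.Iv v ≠ ⊥ →
      MulAut.conj g • X.vertSub v = X.vertSub v) :
    X.Prop13v :=
  X.toDPSCData.prop13v_of_inputs hGRv hDetv hCTv hL (X.infinite_Iv_of_prop_1_3_iii' hiii)

/-- **[AbsTopII] Prop 1.3 (v), middle clause, PROVED from its printed inputs** (proof
p. 16): "`D_v ∩ Π_I = C_{Π_I}(I_v) = N_{Π_I}(I_v) = Z_{Π_I}(I_v)` is commensurably terminal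
in `Π_I`" — GIVEN the inputs of `prop13v_of_prop_1_3_iii'` and Prop 1.3 (iii) as typed
(`Prop_1_3_iii'`: `D_v ∩ Π_I = I_v × Π_v`, `I_v ≅ Ẑ^Σ` — used for "`I_v × Π_v ⊆ Z_{Π_I}(I_v)`",
`I_v` being abelian).  Conclusion: literally `DPSCIndexData.Prop_1_3_v'` (FACT-LIST F-0300).
[cite: MochizukiAbsTopII2013, Prop 1.3 (v) p.12] -/
theorem prop_1_3_v'_of_prop_1_3_iii' (hiii : X.Prop_1_3_iii')
    (hGRv : ∀ (g : X.PiH) (v : X.Vert), ∃ v' : X.Vert, ∃ γ ∈ X.PiG,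
      MulAut.conj g • X.vertSub v = MulAut.conj γ • X.vertSub v')
    (hDetv : ∀ (v v' : X.Vert) (γ : X.PiH), γ ∈ X.PiG →
      (MulAut.conj γ • X.vertSub v' ⊓ X.vertSub v).relIndex (X.vertSub v) ≠ 0 → v' = v)
    (hCTv : ∀ v : X.Vert, IsCommensurablyTerminal ((X.vertSub v).subgroupOf X.PiG))
    (hL : ∀ (v : X.Vert) (g : X.PiH), X.Iv v ⊓ MulAut.conj g • X.Iv v ≠ ⊥ →
      MulAut.conj g • X.vertSub v = X.vertSub v) :
    X.Prop_1_3_v' := by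
  haveI : X.PiG.Normal := X.normal_PiG
  haveI : X.PiI.Normal := X.normal_PiI
  have h13v := X.prop13v_of_prop_1_3_iii' hiii hGRv hDetv hCTv hL
  intro v
  obtain ⟨hC, hNm, hCTD, hDN, -⟩ := h13v v
  have hIvle : X.Iv v ≤ X.PiI := inf_le_right
  -- `C_{Π_I}(I_v)` and `N_{Π_I}(I_v)` are the traces of `C_{Π_H}(I_v) = N_{Π_H}(I_v) = D_v`
  have e1 : (X.Dv v ⊓ X.PiI).subgroupOf X.PiI =
      Subgroup.Commensurable.commensurator ((X.Iv v).subgroupOf X.PiI) := by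
    rw [commensurator_subgroupOf_eq hIvle, ← hC]
  have e2 : (X.Dv v ⊓ X.PiI).subgroupOf X.PiI =
      Subgroup.normalizer (((X.Iv v).subgroupOf X.PiI : Subgroup ↥X.PiI) : Set ↥X.PiI) := by
    rw [← Subgroup.subgroupOf_normalizer_eq hIvle, Subgroup.inf_subgroupOf_right, ← hNm]
  -- `Z_{Π_I}(I_v) = D_v ∩ Π_I`: `⊆` since `Z ⊆ N`; `⊇` since `D_v ∩ Π_I = I_v × Π_v` with `I_v` abelian
  have e3 : (X.Dv v ⊓ X.PiI).subgroupOf X.PiI =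
      Subgroup.centralizer (((X.Iv v).subgroupOf X.PiI : Subgroup ↥X.PiI) : Set ↥X.PiI) := by
    rw [centralizer_subgroupOf_eq hIvle]
    congr 1
    apply le_antisymm
    · obtain ⟨hprod, -⟩ := hiii.1 v
      rw [← hprod.sup_eq]
      refine le_inf (sup_le (X.le_centralizer_Iv_of_prop_1_3_iii' hiii v) ?_)
        (sup_le hIvle (le_trans (X.vertSub_le v) X.PiG_le_PiI))
      rw [Subgroup.le_centralizer_iff]
      exact inf_le_left
    · have : Subgroup.centralizer (X.Iv v : Set X.PiH) ≤ X.Dv v := by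
        rw [show X.Dv v = Subgroup.normalizer (X.Iv v : Set X.PiH) from hNm]
        exact Subgroup.centralizer_le_normalizer _
      exact inf_le_inf_right _ this
  refine ⟨e1, e2, e3, ?_⟩
  -- commensurable terminality of `D_v ∩ Π_I` in `Π_I`
  have hCT : Subgroup.Commensurable.commensurator (X.vertSub v) ⊓ X.PiG ≤ X.vertSub v :=
    (isCommensurablyTerminal_subgroupOf_iff (X.vertSub_le v)).mp (hCTv v)
  have hCN := commensurator_eq_normalizer_of_graphic X.vertSub v (X.vertSub_le v)
    (fun g => hGRv g v) (fun j γ hγ h => hDetv v j γ hγ h) hCT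
  exact isCommensurablyTerminal_normalizer_inf_subgroupOf X.PiI X.PiG_le_PiI hCN hDN

end AbsTopII.DPSCIndexData

end Literature.AnabelianGeometry.AbsoluteAnabelian
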